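import Literature.NumberTheory.Automorphic.IsobaricRigidityRepData
import HarnessLib

/-!
# `ReciprocityUpToIrreducibility` (item stmt-Langlands-14328), line `Sketch`, stub K4
# `stub_isobaricRigidity`: isobaric rigidity at unramified places

The registered stub `stub_isobaricRigidity` of the lead's skeleton (crux
`IrreducibilityBySelfDuality.ReciprocityUpToIrreducibility`, line `Sketch`): GIVEN the two named
facts Arthur–Clozel Ch. 3 (2.2) and (2.3) for Borel–Jacquet data
(`JacquetShalika1981_partialPairL_boundary_repData` — the route input `PairLBoundaryJS` verbatim — and
`JacquetShalika1981_partialPairL_pole_repData`), the Satake family of a cuspidal `π` on `GL_n(𝔸_K)`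
(`n ≥ 1`) is not, at almost all places, a union of Satake families of `k ≥ 2` cuspidal data of positive
ranks (Jacquet–Shalika 1981 II, Thm. 4.4, read at unramified places).  The mathematics is the
Literature theorem `CuspidalAutomorphicRepData.not_eventually_satake_eq_sum_of_JS`
(`Literature/NumberTheory/Automorphic/IsobaricRigidityRepData.lean`); this file only restates it under
the registered name and signature.  No definitions; standard axioms.
-/

noncomputable section

set_option linter.dupNamespace false -- project-wide option (lakefile weak.linter.dupNamespace); `Summit.Langlands.Langlands` is the mandated namespace

open scoped NumberField
open Filter IsDedekindDomain
open Literature.NumberTheory.Automorphic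

namespace Summit.Langlands.Langlands.Theorems.ReciprocityUpToIrreducibility

/-- **Stub K4 of line `Sketch` — isobaric rigidity (Jacquet–Shalika II, Thm. 4.4, at unramified
places), conditional on Arthur–Clozel (2.2)–(2.3) for Borel–Jacquet data.**  For a cuspidal `π` on
`GL_n(𝔸_K)` (`n ≥ 1`) and cuspidal `σ_i` on `GL_{m_i}(𝔸_K)` (`i < k`, `k ≥ 2`, `m_i ≥ 1`) it is not
the case that at almost every place every Satake parameter of `π` is `∑_i β_i` with `β_i` a Satake
parameter of `σ_i`.  Proof: `CuspidalAutomorphicRepData.not_eventually_satake_eq_sum_of_JS` (unitary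
normalisation, Rankin–Selberg factorisation against the contragredient of the `σ_{i₀}` of maximal real
twist, pole count at `s = 1`).
[cite: JacquetShalikaAJM1981II, Thm. 4.4] [cite: ArthurClozelAMS120, Ch. 3 §2 (2.2)–(2.3)] -/
theorem stub_isobaricRigidity :
    JacquetShalika1981_partialPairL_boundary_repData →
    JacquetShalika1981_partialPairL_pole_repData →
    ∀ (K : Type) [Field K] [NumberField K] (n : ℕ) (hcpt : isCompact_glFiniteIntegralLevel n K)
      (π : CuspidalAutomorphicRepData n K hcpt) (k : ℕ) (m : Fin k → ℕ)
      (hm : ∀ i, isCompact_glFiniteIntegralLevel (m i) K)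
      (σ : ∀ i, CuspidalAutomorphicRepData (m i) K (hm i)),
      0 < n → 2 ≤ k → (∀ i, 0 < m i) →
        ¬ ∀ᶠ v : HeightOneSpectrum (𝓞 K) in cofinite, ∀ α : Multiset ℂ, π.1.HasSatakeParamAt v α →
          ∃ β : Fin k → Multiset ℂ, (∀ i, (σ i).1.HasSatakeParamAt v (β i)) ∧ α = ∑ i, β i := by
  intro hJSb hJSp K _ _ n hcpt π k m hm σ hn hk hm0
  exact CuspidalAutomorphicRepData.not_eventually_satake_eq_sum_of_JS hJSb hJSp π σ hn hk hm0

end Summit.Langlands.Langlands.Theorems.ReciprocityUpToIrreducibility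

end
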